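import Mathlib.Tactic.Ring
import Mathlib.Tactic.Linarith
import Mathlib.Tactic.Positivity
import Mathlib.Tactic.LinearCombination
import Mathlib.Data.Real.Basic
import Summits.HodgeConjecture.HodgeConjecture.Theorems.WeilClassTestFormatFiveThreeProductFormula
import Summits.HodgeConjecture.HodgeConjecture.Theorems.WeilClassTestFormatFiveThreeDoublyOneSided
import Summits.HodgeConjecture.HodgeConjecture.Theorems.WeilClassTestFormatFiveThreeDoublyOneSidedKey
import HarnessLib

/-!
# Conjecture N (hodge-weil ladder, GAPS G51b/G51c), format (5,3): THE DOUBLY-ONE-SIDED CLASS, ALL TILTS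

Prover 2, generation 16 (note `run/shared/lean/b2b/hodge-weil/b2b-hweil-pv2-g16/DOS-G16.md`). Setting of `CONJECTURE-N.md` §1 in format
(5,3) (E-roots `(A_e,u_e)`, F-roots `(B_g,v_g)`, centred coordinates; `Q₂`, `Q₄`, purity sums `P1, P2, P4`; pairwise ampleness).
pv2-g15 proved (`WeilClassTestFormatFiveThreeDoublyOneSided.lean`) that on the pure locus `δ³(Q₂ + λQ₄) = 2(Ψ_λ(1) − Ψ_λ(3))` for the
pair `(F₁,F₃)` (`δ = v₃ − v₁`, `Δ = B₃ − B₁`, `Ψ_λ(g) = δ²K₂(g) − δΔK₁(g) + (Δ² − 6λδ²)K₀(g)`), that `−Ψ_{4/3}(3) ≥ 0` for `Δ ≥ 0`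
(`psi_high_nonneg`) and that `Ψ_{4/3}(1) ≥ 0` at SMALL tilt `Δ² − 5Δδ + 2δ² ≥ 0` (`psi_low_nonneg`), whence the class theorem at small tilt.
Here the remaining tilts are settled, so that the whole DOUBLY-ONE-SIDED CLASS (all E-charges between the charges of two F-roots; it contains
pv2-g9's extremal cross configuration `R* = 0.3016…`) satisfies `Q₂ + (4/3)Q₄ ≥ 0` — pv2-g15's LEMMA DOS:
* `dd2_of_pure` — centring + (P4) ⟹ the Leibniz second divided difference `DD2` of `g ↦ ∏_e(u_e − v_g)` over the three F-charges
  vanishes (`DD2 = e₃` of the virtual charge alphabet `= (p₁³ − 3p₁p₂ + 2p₃)/6`);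
* `psi_low_largeTilt` — `Δ ≥ 0`, `3Δ² ≥ 4δ²`: with `t_e := δa_e − Δb_e ≥ 0` (ampleness w.r.t. `F₃`),
  `Ψ(1) = Σ_{i<j}t_it_jb_{∖ij} + 3ΔΣ_it_ib_{∖i} + (6Δ² − 8δ²)∏b ≥ 0` ('all inverse slopes from `F₁` are `≥ Δ/δ`');
* `psi_low_midTilt` — `δ ≤ 3Δ ≤ 9δ`: the slacks satisfy `d_e ≥ δ + Δ − 2b_e` (ampleness w.r.t. `F₃`), so
  `Ψ(1) ≥ ∏b·(−13Δ² + 55Δδ − 16δ²)/2 ≥ 0` PROVIDED the key charge inequality `15∏b ≤ 2δ·e₄(b)`, which is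
  `WeilClassTestFormatFiveThreeDoublyOneSidedKey.key` (y⁰-purity `DD2 = 0` keeps the E-charges off the top F-charge: `Σδ/b_e ≥ 15/2`);
* `allTilts_main` / `allTilts_sorted` — the three tilt ranges cover `Δ ≥ 0`; `Δ ≤ 0` by the reflection `u ↦ −u`;
* **`conjectureN_53_doublyOneSided`** — THEOREM: every centred, pure (P1, P2, P4), pairwise-ample real (5,3) configuration with
  `v₁ ≤ u_e ≤ v₃` for all `e` (the position of `v₂` and the tilt arbitrary) satisfies `Q₂ + (4/3)·Q₄ ≥ 0`. With pv2-g14's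
  `three_phase_combine` this is the complex Conjecture N on this class; it is the first complete `Q₄ < 0` charge class of format (5,3).
Pure algebra; nothing here is a case of HC, a rung or a door edge; no statement of Markman's papers is used. New cell result ⇒ Summits/.
-/

set_option linter.dupNamespace false

open Summit.HodgeConjecture.HodgeConjecture.WeilClassTestFormatFiveThreeProductFormula
open Summit.HodgeConjecture.HodgeConjecture.WeilClassTestFormatFiveThreeDoublyOneSided
open Summit.HodgeConjecture.HodgeConjecture.WeilClassTestFormatFiveThreeDoublyOneSidedKey

namespace Summit.HodgeConjecture.HodgeConjecture.WeilClassTestFormatFiveThreeDoublyOneSidedAllTilts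

/-- y⁰-PURITY AS A DIVIDED DIFFERENCE: centring + (P4) ⟹ the Leibniz form of the second divided difference of
`g ↦ K₀(g) = ∏_e(u_e − v_g)` over the nodes `v₁, v₂, v₃` vanishes (`DD2 = (p₁³ − 3p₁p₂ + 2p₃)/6` for the signed power sums
`p_k = Σu^k − Σv^k`; pv2-g15's 'collinearity of `(v_g, K₀(g))`', division-free). -/
theorem dd2_of_pure (u₁ u₂ u₃ u₄ u₅ v₁ v₂ v₃ : ℝ)
    (hC : u₁ + u₂ + u₃ + u₄ + u₅ = v₁ + v₂ + v₃)
    (hP4 : (u₁ ^ 3 + u₂ ^ 3 + u₃ ^ 3 + u₄ ^ 3 + u₅ ^ 3) - (v₁ ^ 3 + v₂ ^ 3 + v₃ ^ 3) = 0) :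
    (u₃ - v₃) * (u₄ - v₃) * (u₅ - v₃)
        + (u₂ - v₂) * (u₄ - v₃) * (u₅ - v₃)
        + (u₂ - v₂) * (u₃ - v₂) * (u₅ - v₃)
        + (u₂ - v₂) * (u₃ - v₂) * (u₄ - v₂)
        + (u₁ - v₁) * (u₄ - v₃) * (u₅ - v₃)
        + (u₁ - v₁) * (u₃ - v₂) * (u₅ - v₃)
        + (u₁ - v₁) * (u₃ - v₂) * (u₄ - v₂)
        + (u₁ - v₁) * (u₂ - v₁) * (u₅ - v₃)
        + (u₁ - v₁) * (u₂ - v₁) * (u₄ - v₂)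
        + (u₁ - v₁) * (u₂ - v₁) * (u₃ - v₁) = 0 := by
  linear_combination (1 / 3 : ℝ) * hP4 + ((((u₁ + u₂ + u₃ + u₄ + u₅) - (v₁ + v₂ + v₃)) ^ 2 - 3 * ((u₁ ^ 2 + u₂ ^ 2 + u₃ ^ 2 + u₄ ^ 2 + u₅ ^ 2) - (v₁ ^ 2 + v₂ ^ 2 + v₃ ^ 2))) / 6) * hC

/-- LARGE TILT: `Ψ_{4/3}(1) ≥ 0` for the F-root `F₁` weakly below all E-charges once `3Δ² ≥ 4δ²` (`Δ = B₃ − B₁ ≥ 0`,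
`δ = v₃ − v₁`): with `b_e = u_e − v₁ ∈ [0, δ]`, `a_e = A_e − B₁ ≥ δ + Δ − b_e` (ampleness w.r.t. `F₃`) and `t_e := δa_e − Δb_e ≥ 0`,
`Ψ(1) = Σ_{i<j} t_it_j b_{∖ij} + 3Δ·Σ_i t_i b_{∖i} + (6Δ² − 8δ²)·∏b`. -/
theorem psi_low_largeTilt (a₁ a₂ a₃ a₄ a₅ b₁ b₂ b₃ b₄ b₅ δ Δ : ℝ)
    (hb₁ : 0 ≤ b₁) (hb₂ : 0 ≤ b₂) (hb₃ : 0 ≤ b₃) (hb₄ : 0 ≤ b₄) (hb₅ : 0 ≤ b₅)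
    (hc₁ : b₁ ≤ δ) (hc₂ : b₂ ≤ δ) (hc₃ : b₃ ≤ δ) (hc₄ : b₄ ≤ δ) (hc₅ : b₅ ≤ δ)
    (ha₁ : δ + Δ - b₁ ≤ a₁) (ha₂ : δ + Δ - b₂ ≤ a₂) (ha₃ : δ + Δ - b₃ ≤ a₃) (ha₄ : δ + Δ - b₄ ≤ a₄) (ha₅ : δ + Δ - b₅ ≤ a₅)
    (hδ : 0 ≤ δ) (hΔ : 0 ≤ Δ) (hl : 4 * δ ^ 2 ≤ 3 * Δ ^ 2) :
    0 ≤ δ ^ 2 * (a₁ * a₂ * b₃ * b₄ * b₅ + a₁ * a₃ * b₂ * b₄ * b₅ + a₁ * a₄ * b₂ * b₃ * b₅ + a₁ * a₅ * b₂ * b₃ * b₄ + a₂ * a₃ * b₁ * b₄ * b₅ + a₂ * a₄ * b₁ * b₃ * b₅ + a₂ * a₅ * b₁ * b₃ * b₄ + a₃ * a₄ * b₁ * b₂ * b₅ + a₃ * a₅ * b₁ * b₂ * b₄ + a₄ * a₅ * b₁ * b₂ * b₃)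
      - δ * Δ * (a₁ * b₂ * b₃ * b₄ * b₅ + a₂ * b₁ * b₃ * b₄ * b₅ + a₃ * b₁ * b₂ * b₄ * b₅ + a₄ * b₁ * b₂ * b₃ * b₅ + a₅ * b₁ * b₂ * b₃ * b₄)
      + (Δ ^ 2 - 8 * δ ^ 2) * (b₁ * b₂ * b₃ * b₄ * b₅) := by
  have ht₁ : 0 ≤ δ * a₁ - Δ * b₁ := by
    linarith only [mul_le_mul_of_nonneg_left ha₁ hδ, mul_nonneg (add_nonneg hδ hΔ) (sub_nonneg.mpr hc₁)]
  have ht₂ : 0 ≤ δ * a₂ - Δ * b₂ := by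
    linarith only [mul_le_mul_of_nonneg_left ha₂ hδ, mul_nonneg (add_nonneg hδ hΔ) (sub_nonneg.mpr hc₂)]
  have ht₃ : 0 ≤ δ * a₃ - Δ * b₃ := by
    linarith only [mul_le_mul_of_nonneg_left ha₃ hδ, mul_nonneg (add_nonneg hδ hΔ) (sub_nonneg.mpr hc₃)]
  have ht₄ : 0 ≤ δ * a₄ - Δ * b₄ := by
    linarith only [mul_le_mul_of_nonneg_left ha₄ hδ, mul_nonneg (add_nonneg hδ hΔ) (sub_nonneg.mpr hc₄)]
  have ht₅ : 0 ≤ δ * a₅ - Δ * b₅ := by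
    linarith only [mul_le_mul_of_nonneg_left ha₅ hδ, mul_nonneg (add_nonneg hδ hΔ) (sub_nonneg.mpr hc₅)]
  have e : δ ^ 2 * (a₁ * a₂ * b₃ * b₄ * b₅ + a₁ * a₃ * b₂ * b₄ * b₅ + a₁ * a₄ * b₂ * b₃ * b₅ + a₁ * a₅ * b₂ * b₃ * b₄ + a₂ * a₃ * b₁ * b₄ * b₅ + a₂ * a₄ * b₁ * b₃ * b₅ + a₂ * a₅ * b₁ * b₃ * b₄ + a₃ * a₄ * b₁ * b₂ * b₅ + a₃ * a₅ * b₁ * b₂ * b₄ + a₄ * a₅ * b₁ * b₂ * b₃)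
      - δ * Δ * (a₁ * b₂ * b₃ * b₄ * b₅ + a₂ * b₁ * b₃ * b₄ * b₅ + a₃ * b₁ * b₂ * b₄ * b₅ + a₄ * b₁ * b₂ * b₃ * b₅ + a₅ * b₁ * b₂ * b₃ * b₄)
      + (Δ ^ 2 - 8 * δ ^ 2) * (b₁ * b₂ * b₃ * b₄ * b₅)
      = ((δ * a₁ - Δ * b₁) * (δ * a₂ - Δ * b₂) * (b₃ * b₄ * b₅) + (δ * a₁ - Δ * b₁) * (δ * a₃ - Δ * b₃) * (b₂ * b₄ * b₅) + (δ * a₁ - Δ * b₁) * (δ * a₄ - Δ * b₄) * (b₂ * b₃ * b₅) + (δ * a₁ - Δ * b₁) * (δ * a₅ - Δ * b₅) * (b₂ * b₃ * b₄) + (δ * a₂ - Δ * b₂) * (δ * a₃ - Δ * b₃) * (b₁ * b₄ * b₅) + (δ * a₂ - Δ * b₂) * (δ * a₄ - Δ * b₄) * (b₁ * b₃ * b₅) + (δ * a₂ - Δ * b₂) * (δ * a₅ - Δ * b₅) * (b₁ * b₃ * b₄) + (δ * a₃ - Δ * b₃) * (δ * a₄ - Δ * b₄) * (b₁ * b₂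 * b₅) + (δ * a₃ - Δ * b₃) * (δ * a₅ - Δ * b₅) * (b₁ * b₂ * b₄) + (δ * a₄ - Δ * b₄) * (δ * a₅ - Δ * b₅) * (b₁ * b₂ * b₃))
        + 3 * Δ * ((δ * a₁ - Δ * b₁) * (b₂ * b₃ * b₄ * b₅) + (δ * a₂ - Δ * b₂) * (b₁ * b₃ * b₄ * b₅) + (δ * a₃ - Δ * b₃) * (b₁ * b₂ * b₄ * b₅) + (δ * a₄ - Δ * b₄) * (b₁ * b₂ * b₃ * b₅) + (δ * a₅ - Δ * b₅) * (b₁ * b₂ * b₃ * b₄))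
        + (6 * Δ ^ 2 - 8 * δ ^ 2) * (b₁ * b₂ * b₃ * b₄ * b₅) := by ring
  rw [e]
  have hcoef : 0 ≤ 6 * Δ ^ 2 - 8 * δ ^ 2 := by linarith
  generalize (δ * a₁ - Δ * b₁) = T₁ at ht₁ ⊢
  generalize (δ * a₂ - Δ * b₂) = T₂ at ht₂ ⊢
  generalize (δ * a₃ - Δ * b₃) = T₃ at ht₃ ⊢
  generalize (δ * a₄ - Δ * b₄) = T₄ at ht₄ ⊢
  generalize (δ * a₅ - Δ * b₅) = T₅ at ht₅ ⊢
  positivity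

/-- MID TILT: `Ψ_{4/3}(1) ≥ 0` for the F-root `F₁` weakly below all E-charges when `δ ≤ 3Δ ≤ 9δ`, GIVEN the key charge
inequality `15∏b ≤ 2δ·e₄(b)` (`WeilClassTestFormatFiveThreeDoublyOneSidedKey.key`): with `a_e = b_e + d_e`, `d_e ≥ 0` and
`d_e ≥ δ + Δ − 2b_e` (ampleness w.r.t. `F₁` and `F₃`),
`Ψ(1) = (Δ²−5Δδ+2δ²)∏b + δ(4δ−Δ)Σd_ib_{∖i} + δ²Σd_id_jb_{∖ij} ≥ ∏b·(−13Δ² + 55Δδ − 16δ²)/2 ≥ 0`. -/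
theorem psi_low_midTilt (b₁ b₂ b₃ b₄ b₅ d₁ d₂ d₃ d₄ d₅ δ Δ : ℝ)
    (hb₁ : 0 ≤ b₁) (hb₂ : 0 ≤ b₂) (hb₃ : 0 ≤ b₃) (hb₄ : 0 ≤ b₄) (hb₅ : 0 ≤ b₅)
    (hd₁ : 0 ≤ d₁) (hd₂ : 0 ≤ d₂) (hd₃ : 0 ≤ d₃) (hd₄ : 0 ≤ d₄) (hd₅ : 0 ≤ d₅)
    (hq₁ : δ + Δ - 2 * b₁ ≤ d₁) (hq₂ : δ + Δ - 2 * b₂ ≤ d₂) (hq₃ : δ + Δ - 2 * b₃ ≤ d₃) (hq₄ : δ + Δ - 2 * b₄ ≤ d₄) (hq₅ : δ + Δ - 2 * b₅ ≤ d₅)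
    (hδ : 0 ≤ δ) (hlo : δ ≤ 3 * Δ) (hhi : Δ ≤ 3 * δ)
    (hkey : 15 * (b₁ * b₂ * b₃ * b₄ * b₅) ≤ 2 * δ * (b₂ * b₃ * b₄ * b₅ + b₁ * b₃ * b₄ * b₅ + b₁ * b₂ * b₄ * b₅ + b₁ * b₂ * b₃ * b₅ + b₁ * b₂ * b₃ * b₄)) :
    0 ≤ δ ^ 2 * ((b₁ + d₁) * (b₂ + d₂) * b₃ * b₄ * b₅ + (b₁ + d₁) * (b₃ + d₃) * b₂ * b₄ * b₅ + (b₁ + d₁) * (b₄ + d₄) * b₂ * b₃ * b₅ + (b₁ + d₁) * (b₅ + d₅) * b₂ * b₃ * b₄ + (b₂ + d₂) * (b₃ + d₃) * b₁ * b₄ * b₅ + (b₂ + d₂) * (b₄ + d₄) * b₁ * b₃ * b₅ + (b₂ + d₂) * (b₅ + d₅) * b₁ * b₃ * b₄ + (b₃ + d₃) * (b₄ + d₄) * b₁ * b₂ * b₅ + (b₃ + d₃) * (b₅ + d₅) * b₁ * b₂ * b₄ + (b₄ + d₄) * (b₅ + d₅) * b₁ * b₂ * b₃)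
      - δ * Δ * ((b₁ + d₁) * b₂ * b₃ * b₄ * b₅ + (b₂ + d₂) * b₁ * b₃ * b₄ * b₅ + (b₃ + d₃) * b₁ * b₂ * b₄ * b₅ + (b₄ + d₄) * b₁ * b₂ * b₃ * b₅ + (b₅ + d₅) * b₁ * b₂ * b₃ * b₄)
      + (Δ ^ 2 - 8 * δ ^ 2) * (b₁ * b₂ * b₃ * b₄ * b₅) := by
  have e : δ ^ 2 * ((b₁ + d₁) * (b₂ + d₂) * b₃ * b₄ * b₅ + (b₁ + d₁) * (b₃ + d₃) * b₂ * b₄ * b₅ + (b₁ + d₁) * (b₄ + d₄) * b₂ * b₃ * b₅ + (b₁ + d₁) * (b₅ + d₅) * b₂ * b₃ * b₄ + (b₂ + d₂) * (b₃ + d₃) * b₁ * b₄ * b₅ + (b₂ + d₂) * (b₄ + d₄) * b₁ * b₃ * b₅ + (b₂ + d₂) * (b₅ + d₅) * b₁ * b₃ * b₄ + (b₃ + d₃) * (b₄ + d₄) * b₁ * b₂ * b₅ + (b₃ + d₃) * (b₅ + d₅) * b₁ * b₂ * b₄ + (b₄ + d₄) * (b₅ + d₅) * b₁ * b₂ * 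b₃)
      - δ * Δ * ((b₁ + d₁) * b₂ * b₃ * b₄ * b₅ + (b₂ + d₂) * b₁ * b₃ * b₄ * b₅ + (b₃ + d₃) * b₁ * b₂ * b₄ * b₅ + (b₄ + d₄) * b₁ * b₂ * b₃ * b₅ + (b₅ + d₅) * b₁ * b₂ * b₃ * b₄)
      + (Δ ^ 2 - 8 * δ ^ 2) * (b₁ * b₂ * b₃ * b₄ * b₅)
      = (Δ ^ 2 - 5 * Δ * δ + 2 * δ ^ 2) * (b₁ * b₂ * b₃ * b₄ * b₅) + δ * (4 * δ - Δ) * (d₁ * (b₂ * b₃ * b₄ * b₅) + d₂ * (b₁ * b₃ * b₄ * b₅) + d₃ * (b₁ * b₂ * b₄ * b₅) + d₄ * (b₁ * b₂ * b₃ * b₅) + d₅ * (b₁ * b₂ * b₃ * b₄))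
        + δ ^ 2 * (d₁ * d₂ * (b₃ * b₄ * b₅) + d₁ * d₃ * (b₂ * b₄ * b₅) + d₁ * d₄ * (b₂ * b₃ * b₅) + d₁ * d₅ * (b₂ * b₃ * b₄) + d₂ * d₃ * (b₁ * b₄ * b₅) + d₂ * d₄ * (b₁ * b₃ * b₅) + d₂ * d₅ * (b₁ * b₃ * b₄) + d₃ * d₄ * (b₁ * b₂ * b₅) + d₃ * d₅ * (b₁ * b₂ * b₄) + d₄ * d₅ * (b₁ * b₂ * b₃)) := by ring
  rw [e]
  have hP : 0 ≤ b₁ * b₂ * b₃ * b₄ * b₅ := by positivity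
  have hY : 0 ≤ d₁ * d₂ * (b₃ * b₄ * b₅) + d₁ * d₃ * (b₂ * b₄ * b₅) + d₁ * d₄ * (b₂ * b₃ * b₅) + d₁ * d₅ * (b₂ * b₃ * b₄) + d₂ * d₃ * (b₁ * b₄ * b₅) + d₂ * d₄ * (b₁ * b₃ * b₅) + d₂ * d₅ * (b₁ * b₃ * b₄) + d₃ * d₄ * (b₁ * b₂ * b₅) + d₃ * d₅ * (b₁ * b₂ * b₄) + d₄ * d₅ * (b₁ * b₂ * b₃) := by positivity
  have h4 : 0 ≤ 4 * δ - Δ := by linarith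
  have q₁ : (δ + Δ - 2 * b₁) * (b₂ * b₃ * b₄ * b₅) ≤ d₁ * (b₂ * b₃ * b₄ * b₅) :=
    mul_le_mul_of_nonneg_right hq₁ (by positivity)
  have q₂ : (δ + Δ - 2 * b₂) * (b₁ * b₃ * b₄ * b₅) ≤ d₂ * (b₁ * b₃ * b₄ * b₅) :=
    mul_le_mul_of_nonneg_right hq₂ (by positivity)
  have q₃ : (δ + Δ - 2 * b₃) * (b₁ * b₂ * b₄ * b₅) ≤ d₃ * (b₁ * b₂ * b₄ * b₅) :=
    mul_le_mul_of_nonneg_right hq₃ (by positivity)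
  have q₄ : (δ + Δ - 2 * b₄) * (b₁ * b₂ * b₃ * b₅) ≤ d₄ * (b₁ * b₂ * b₃ * b₅) :=
    mul_le_mul_of_nonneg_right hq₄ (by positivity)
  have q₅ : (δ + Δ - 2 * b₅) * (b₁ * b₂ * b₃ * b₄) ≤ d₅ * (b₁ * b₂ * b₃ * b₄) :=
    mul_le_mul_of_nonneg_right hq₅ (by positivity)
  have hX : (δ + Δ - 2 * b₁) * (b₂ * b₃ * b₄ * b₅) + (δ + Δ - 2 * b₂) * (b₁ * b₃ * b₄ * b₅) + (δ + Δ - 2 * b₃) * (b₁ * b₂ * b₄ * b₅) + (δ + Δ - 2 * b₄) * (b₁ * b₂ * b₃ * b₅) + (δ + Δ - 2 * b₅) * (b₁ * b₂ * b₃ * b₄)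
      ≤ d₁ * (b₂ * b₃ * b₄ * b₅) + d₂ * (b₁ * b₃ * b₄ * b₅) + d₃ * (b₁ * b₂ * b₄ * b₅) + d₄ * (b₁ * b₂ * b₃ * b₅) + d₅ * (b₁ * b₂ * b₃ * b₄) := by linarith only [q₁, q₂, q₃, q₄, q₅]
  have s1 := mul_le_mul_of_nonneg_left hX (mul_nonneg hδ h4)
  have hcoef : 0 ≤ (4 * δ - Δ) * (δ + Δ) := mul_nonneg h4 (by linarith)
  have s2 := mul_le_mul_of_nonneg_left hkey hcoef
  have hquad : 0 ≤ -13 * Δ ^ 2 + 55 * Δ * δ - 16 * δ ^ 2 := by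
    linarith only [mul_nonneg (show 0 ≤ 3 * Δ - δ by linarith) (show 0 ≤ 3 * δ - Δ by linarith),
      mul_nonneg hδ (show 0 ≤ 35 * Δ - 9 * δ by linarith)]
  have s3 : 0 ≤ (b₁ * b₂ * b₃ * b₄ * b₅) * (-13 * Δ ^ 2 + 55 * Δ * δ - 16 * δ ^ 2) := mul_nonneg hP hquad
  have s4 : 0 ≤ δ ^ 2 * (d₁ * d₂ * (b₃ * b₄ * b₅) + d₁ * d₃ * (b₂ * b₄ * b₅) + d₁ * d₄ * (b₂ * b₃ * b₅) + d₁ * d₅ * (b₂ * b₃ * b₄) + d₂ * d₃ * (b₁ * b₄ * b₅) + d₂ * d₄ * (b₁ * b₃ * b₅) + d₂ * d₅ * (b₁ * b₃ * b₄) + d₃ * d₄ * (b₁ * b₂ * b₅) + d₃ * d₅ * (b₁ * b₂ * b₄) + d₄ * d₅ * (b₁ * b₂ * b₃)) := mul_nonneg (sq_nonneg δ) hY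
  linarith only [s1, s2, s3, s4]

/-- Main case (sorted F-charges `v₁ ≤ v₂ ≤ v₃`, `v₁ < v₃`, nonnegative tilt `B₁ ≤ B₃`): `δ³·(Q₂ + (4/3)Q₄) ≥ 0`.
The ampleness hypotheses w.r.t. `F₂` are not needed. -/
theorem allTilts_main (A₁ A₂ A₃ A₄ A₅ B₁ B₂ B₃ u₁ u₂ u₃ u₄ u₅ v₁ v₂ v₃ : ℝ)
    (hA : A₁ + A₂ + A₃ + A₄ + A₅ = B₁ + B₂ + B₃) (hC : u₁ + u₂ + u₃ + u₄ + u₅ = v₁ + v₂ + v₃)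
    (hP1 : (A₁ ^ 2 * u₁ + A₂ ^ 2 * u₂ + A₃ ^ 2 * u₃ + A₄ ^ 2 * u₄ + A₅ ^ 2 * u₅) - (B₁ ^ 2 * v₁ + B₂ ^ 2 * v₂ + B₃ ^ 2 * v₃) = 0)
    (hP2 : (A₁ * u₁ ^ 2 + A₂ * u₂ ^ 2 + A₃ * u₃ ^ 2 + A₄ * u₄ ^ 2 + A₅ * u₅ ^ 2) - (B₁ * v₁ ^ 2 + B₂ * v₂ ^ 2 + B₃ * v₃ ^ 2) = 0)
    (hP4 : (u₁ ^ 3 + u₂ ^ 3 + u₃ ^ 3 + u₄ ^ 3 + u₅ ^ 3) - (v₁ ^ 3 + v₂ ^ 3 + v₃ ^ 3) = 0)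
    (m₁₁ : |u₁ - v₁| ≤ A₁ - B₁) (m₂₁ : |u₂ - v₁| ≤ A₂ - B₁) (m₃₁ : |u₃ - v₁| ≤ A₃ - B₁) (m₄₁ : |u₄ - v₁| ≤ A₄ - B₁) (m₅₁ : |u₅ - v₁| ≤ A₅ - B₁)
    (m₁₃ : |u₁ - v₃| ≤ A₁ - B₃) (m₂₃ : |u₂ - v₃| ≤ A₂ - B₃) (m₃₃ : |u₃ - v₃| ≤ A₃ - B₃) (m₄₃ : |u₄ - v₃| ≤ A₄ - B₃) (m₅₃ : |u₅ - v₃| ≤ A₅ - B₃)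
    (lo₁ : v₁ ≤ u₁) (lo₂ : v₁ ≤ u₂) (lo₃ : v₁ ≤ u₃) (lo₄ : v₁ ≤ u₄) (lo₅ : v₁ ≤ u₅)
    (hi₁ : u₁ ≤ v₃) (hi₂ : u₂ ≤ v₃) (hi₃ : u₃ ≤ v₃) (hi₄ : u₄ ≤ v₃) (hi₅ : u₅ ≤ v₃)
    (h12 : v₁ ≤ v₂) (h23 : v₂ ≤ v₃) (hB : B₁ ≤ B₃) (hlt : v₁ < v₃) :
    0 ≤ (v₃ - v₁) ^ 3 * ((1 / 2) * ((A₁ ^ 2 + A₂ ^ 2 + A₃ ^ 2 + A₄ ^ 2 + A₅ ^ 2) - (B₁ ^ 2 + B₂ ^ 2 + B₃ ^ 2)) * ((u₁ ^ 2 + u₂ ^ 2 + u₃ ^ 2 + u₄ ^ 2 + u₅ ^ 2) - (v₁ ^ 2 + v₂ ^ 2 + v₃ ^ 2))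
        + ((A₁ * u₁ + A₂ * u₂ + A₃ * u₃ + A₄ * u₄ + A₅ * u₅) - (B₁ * v₁ + B₂ * v₂ + B₃ * v₃)) ^ 2
        - 3 * ((A₁ ^ 2 * u₁ ^ 2 + A₂ ^ 2 * u₂ ^ 2 + A₃ ^ 2 * u₃ ^ 2 + A₄ ^ 2 * u₄ ^ 2 + A₅ ^ 2 * u₅ ^ 2) - (B₁ ^ 2 * v₁ ^ 2 + B₂ ^ 2 * v₂ ^ 2 + B₃ ^ 2 * v₃ ^ 2))
      + (4 / 3) * (3 * ((u₁ ^ 4 + u₂ ^ 4 + u₃ ^ 4 + u₄ ^ 4 + u₅ ^ 4) - (v₁ ^ 4 + v₂ ^ 4 + v₃ ^ 4)) - (3 / 2) * ((u₁ ^ 2 + u₂ ^ 2 + u₃ ^ 2 + u₄ ^ 2 + u₅ ^ 2) - (v₁ ^ 2 + v₂ ^ 2 + v₃ ^ 2)) ^ 2)) := by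
  have hδ : 0 < v₃ - v₁ := sub_pos.mpr hlt
  have hΔ : 0 ≤ B₃ - B₁ := sub_nonneg.mpr hB
  have bp₁ : 0 ≤ u₁ - v₁ := sub_nonneg.mpr lo₁
  have bp₂ : 0 ≤ u₂ - v₁ := sub_nonneg.mpr lo₂
  have bp₃ : 0 ≤ u₃ - v₁ := sub_nonneg.mpr lo₃
  have bp₄ : 0 ≤ u₄ - v₁ := sub_nonneg.mpr lo₄
  have bp₅ : 0 ≤ u₅ - v₁ := sub_nonneg.mpr lo₅
  have cp₁ : 0 ≤ v₃ - u₁ := sub_nonneg.mpr hi₁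
  have cp₂ : 0 ≤ v₃ - u₂ := sub_nonneg.mpr hi₂
  have cp₃ : 0 ≤ v₃ - u₃ := sub_nonneg.mpr hi₃
  have cp₄ : 0 ≤ v₃ - u₄ := sub_nonneg.mpr hi₄
  have cp₅ : 0 ≤ v₃ - u₅ := sub_nonneg.mpr hi₅
  have al₁ : u₁ - v₁ ≤ A₁ - B₁ := le_trans (le_abs_self _) m₁₁
  have al₂ : u₂ - v₁ ≤ A₂ - B₁ := le_trans (le_abs_self _) m₂₁
  have al₃ : u₃ - v₁ ≤ A₃ - B₁ := le_trans (le_abs_self _) m₃₁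
  have al₄ : u₄ - v₁ ≤ A₄ - B₁ := le_trans (le_abs_self _) m₄₁
  have al₅ : u₅ - v₁ ≤ A₅ - B₁ := le_trans (le_abs_self _) m₅₁
  have ah₁ : v₃ - u₁ ≤ A₁ - B₃ := by linarith only [neg_abs_le (u₁ - v₃), m₁₃]
  have ah₂ : v₃ - u₂ ≤ A₂ - B₃ := by linarith only [neg_abs_le (u₂ - v₃), m₂₃]
  have ah₃ : v₃ - u₃ ≤ A₃ - B₃ := by linarith only [neg_abs_le (u₃ - v₃), m₃₃]
  have ah₄ : v₃ - u₄ ≤ A₄ - B₃ := by linarith only [neg_abs_le (u₄ - v₃), m₄₃]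
  have ah₅ : v₃ - u₅ ≤ A₅ - B₃ := by linarith only [neg_abs_le (u₅ - v₃), m₅₃]
  have dl₁ : 0 ≤ (A₁ - B₁) - (u₁ - v₁) := sub_nonneg.mpr al₁
  have dl₂ : 0 ≤ (A₂ - B₁) - (u₂ - v₁) := sub_nonneg.mpr al₂
  have dl₃ : 0 ≤ (A₃ - B₁) - (u₃ - v₁) := sub_nonneg.mpr al₃
  have dl₄ : 0 ≤ (A₄ - B₁) - (u₄ - v₁) := sub_nonneg.mpr al₄
  have dl₅ : 0 ≤ (A₅ - B₁) - (u₅ - v₁) := sub_nonneg.mpr al₅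
  have dh₁ : 0 ≤ (A₁ - B₃) - (v₃ - u₁) := sub_nonneg.mpr ah₁
  have dh₂ : 0 ≤ (A₂ - B₃) - (v₃ - u₂) := sub_nonneg.mpr ah₂
  have dh₃ : 0 ≤ (A₃ - B₃) - (v₃ - u₃) := sub_nonneg.mpr ah₃
  have dh₄ : 0 ≤ (A₄ - B₃) - (v₃ - u₄) := sub_nonneg.mpr ah₄
  have dh₅ : 0 ≤ (A₅ - B₃) - (v₃ - u₅) := sub_nonneg.mpr ah₅
  have hc₁ : u₁ - v₁ ≤ v₃ - v₁ := by linarith only [hi₁]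
  have hc₂ : u₂ - v₁ ≤ v₃ - v₁ := by linarith only [hi₂]
  have hc₃ : u₃ - v₁ ≤ v₃ - v₁ := by linarith only [hi₃]
  have hc₄ : u₄ - v₁ ≤ v₃ - v₁ := by linarith only [hi₄]
  have hc₅ : u₅ - v₁ ≤ v₃ - v₁ := by linarith only [hi₅]
  have ha₁ : (v₃ - v₁) + (B₃ - B₁) - (u₁ - v₁) ≤ A₁ - B₁ := by linarith only [ah₁]
  have ha₂ : (v₃ - v₁) + (B₃ - B₁) - (u₂ - v₁) ≤ A₂ - B₁ := by linarith only [ah₂]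
  have ha₃ : (v₃ - v₁) + (B₃ - B₁) - (u₃ - v₁) ≤ A₃ - B₁ := by linarith only [ah₃]
  have ha₄ : (v₃ - v₁) + (B₃ - B₁) - (u₄ - v₁) ≤ A₄ - B₁ := by linarith only [ah₄]
  have ha₅ : (v₃ - v₁) + (B₃ - B₁) - (u₅ - v₁) ≤ A₅ - B₁ := by linarith only [ah₅]
  have hq₁ : (v₃ - v₁) + (B₃ - B₁) - 2 * (u₁ - v₁) ≤ (A₁ - B₁) - (u₁ - v₁) := by linarith only [ah₁]
  have hq₂ : (v₃ - v₁) + (B₃ - B₁) - 2 * (u₂ - v₁) ≤ (A₂ - B₁) - (u₂ - v₁) := by linarith only [ah₂]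
  have hq₃ : (v₃ - v₁) + (B₃ - B₁) - 2 * (u₃ - v₁) ≤ (A₃ - B₁) - (u₃ - v₁) := by linarith only [ah₃]
  have hq₄ : (v₃ - v₁) + (B₃ - B₁) - 2 * (u₄ - v₁) ≤ (A₄ - B₁) - (u₄ - v₁) := by linarith only [ah₄]
  have hq₅ : (v₃ - v₁) + (B₃ - B₁) - 2 * (u₅ - v₁) ≤ (A₅ - B₁) - (u₅ - v₁) := by linarith only [ah₅]
  have h2 : 0 ≤ (B₃ - B₁) ^ 2 + 5 * (B₃ - B₁) * (v₃ - v₁) + 2 * (v₃ - v₁) ^ 2 := by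
    linarith only [sq_nonneg (B₃ - B₁), sq_nonneg (v₃ - v₁), mul_nonneg hΔ hδ.le]
  have h5 : 0 ≤ 4 * (v₃ - v₁) + (B₃ - B₁) := by linarith only [hδ, hΔ]
  have kh := psi_high_nonneg (v₃ - u₁) (v₃ - u₂) (v₃ - u₃) (v₃ - u₄) (v₃ - u₅)
    ((A₁ - B₃) - (v₃ - u₁)) ((A₂ - B₃) - (v₃ - u₂)) ((A₃ - B₃) - (v₃ - u₃)) ((A₄ - B₃) - (v₃ - u₄)) ((A₅ - B₃) - (v₃ - u₅)) (v₃ - v₁) (B₃ - B₁)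
    cp₁ cp₂ cp₃ cp₄ cp₅ dh₁ dh₂ dh₃ dh₄ dh₅ hδ.le h2 h5
  have hhigh : 0 ≤ -((v₃ - v₁) ^ 2 * ((A₁ - B₃) * (A₂ - B₃) * (u₃ - v₃) * (u₄ - v₃) * (u₅ - v₃)
        + (A₁ - B₃) * (A₃ - B₃) * (u₂ - v₃) * (u₄ - v₃) * (u₅ - v₃)
        + (A₁ - B₃) * (A₄ - B₃) * (u₂ - v₃) * (u₃ - v₃) * (u₅ - v₃)
        + (A₁ - B₃) * (A₅ - B₃) * (u₂ - v₃) * (u₃ - v₃) * (u₄ - v₃)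
        + (A₂ - B₃) * (A₃ - B₃) * (u₁ - v₃) * (u₄ - v₃) * (u₅ - v₃)
        + (A₂ - B₃) * (A₄ - B₃) * (u₁ - v₃) * (u₃ - v₃) * (u₅ - v₃)
        + (A₂ - B₃) * (A₅ - B₃) * (u₁ - v₃) * (u₃ - v₃) * (u₄ - v₃)
        + (A₃ - B₃) * (A₄ - B₃) * (u₁ - v₃) * (u₂ - v₃) * (u₅ - v₃)
        + (A₃ - B₃) * (A₅ - B₃) * (u₁ - v₃) * (u₂ - v₃) * (u₄ - v₃)
        + (A₄ - B₃) * (A₅ - B₃) * (u₁ - v₃) * (u₂ - v₃) * (u₃ - v₃))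
      - (v₃ - v₁) * (B₃ - B₁) * ((A₁ - B₃) * (u₂ - v₃) * (u₃ - v₃) * (u₄ - v₃) * (u₅ - v₃) + (A₂ - B₃) * (u₁ - v₃) * (u₃ - v₃) * (u₄ - v₃) * (u₅ - v₃) + (A₃ - B₃) * (u₁ - v₃) * (u₂ - v₃) * (u₄ - v₃) * (u₅ - v₃) + (A₄ - B₃) * (u₁ - v₃) * (u₂ - v₃) * (u₃ - v₃) * (u₅ - v₃) + (A₅ - B₃) * (u₁ - v₃) * (u₂ - v₃) * (u₃ - v₃) * (u₄ - v₃))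
      + ((B₃ - B₁) ^ 2 - 6 * (4 / 3) * (v₃ - v₁) ^ 2) * ((u₁ - v₃) * (u₂ - v₃) * (u₃ - v₃) * (u₄ - v₃) * (u₅ - v₃))) := by
    linear_combination kh
  have hlow : 0 ≤ (v₃ - v₁) ^ 2 * ((A₁ - B₁) * (A₂ - B₁) * (u₃ - v₁) * (u₄ - v₁) * (u₅ - v₁)
        + (A₁ - B₁) * (A₃ - B₁) * (u₂ - v₁) * (u₄ - v₁) * (u₅ - v₁)
        + (A₁ - B₁) * (A₄ - B₁) * (u₂ - v₁) * (u₃ - v₁) * (u₅ - v₁)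
        + (A₁ - B₁) * (A₅ - B₁) * (u₂ - v₁) * (u₃ - v₁) * (u₄ - v₁)
        + (A₂ - B₁) * (A₃ - B₁) * (u₁ - v₁) * (u₄ - v₁) * (u₅ - v₁)
        + (A₂ - B₁) * (A₄ - B₁) * (u₁ - v₁) * (u₃ - v₁) * (u₅ - v₁)
        + (A₂ - B₁) * (A₅ - B₁) * (u₁ - v₁) * (u₃ - v₁) * (u₄ - v₁)
        + (A₃ - B₁) * (A₄ - B₁) * (u₁ - v₁) * (u₂ - v₁) * (u₅ - v₁)
        + (A₃ - B₁) * (A₅ - B₁) * (u₁ - v₁) * (u₂ - v₁) * (u₄ - v₁)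
        + (A₄ - B₁) * (A₅ - B₁) * (u₁ - v₁) * (u₂ - v₁) * (u₃ - v₁))
      - (v₃ - v₁) * (B₃ - B₁) * ((A₁ - B₁) * (u₂ - v₁) * (u₃ - v₁) * (u₄ - v₁) * (u₅ - v₁) + (A₂ - B₁) * (u₁ - v₁) * (u₃ - v₁) * (u₄ - v₁) * (u₅ - v₁) + (A₃ - B₁) * (u₁ - v₁) * (u₂ - v₁) * (u₄ - v₁) * (u₅ - v₁) + (A₄ - B₁) * (u₁ - v₁) * (u₂ - v₁) * (u₃ - v₁) * (u₅ - v₁) + (A₅ - B₁) * (u₁ - v₁) * (u₂ - v₁) * (u₃ - v₁) * (u₄ - v₁))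
      + ((B₃ - B₁) ^ 2 - 6 * (4 / 3) * (v₃ - v₁) ^ 2) * ((u₁ - v₁) * (u₂ - v₁) * (u₃ - v₁) * (u₄ - v₁) * (u₅ - v₁)) := by
    by_cases hs : (0 ≤ (B₃ - B₁) ^ 2 - 5 * (B₃ - B₁) * (v₃ - v₁) + 2 * (v₃ - v₁) ^ 2 ∧ B₃ - B₁ ≤ 4 * (v₃ - v₁))
    · have kl := psi_low_nonneg (u₁ - v₁) (u₂ - v₁) (u₃ - v₁) (u₄ - v₁) (u₅ - v₁)
        ((A₁ - B₁) - (u₁ - v₁)) ((A₂ - B₁) - (u₂ - v₁)) ((A₃ - B₁) - (u₃ - v₁)) ((A₄ - B₁) - (u₄ - v₁)) ((A₅ - B₁) - (u₅ - v₁)) (v₃ - v₁) (B₃ - B₁)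
        bp₁ bp₂ bp₃ bp₄ bp₅ dl₁ dl₂ dl₃ dl₄ dl₅ hδ.le hs.1 (by linarith only [hs.2])
      linear_combination kl
    · by_cases hl : 4 * (v₃ - v₁) ^ 2 ≤ 3 * (B₃ - B₁) ^ 2
      · have kl := psi_low_largeTilt (A₁ - B₁) (A₂ - B₁) (A₃ - B₁) (A₄ - B₁) (A₅ - B₁) (u₁ - v₁) (u₂ - v₁) (u₃ - v₁) (u₄ - v₁) (u₅ - v₁) (v₃ - v₁) (B₃ - B₁)
          bp₁ bp₂ bp₃ bp₄ bp₅ hc₁ hc₂ hc₃ hc₄ hc₅ ha₁ ha₂ ha₃ ha₄ ha₅ hδ.le hΔ hl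
        linear_combination kl
      · have hhi' : B₃ - B₁ ≤ 3 * (v₃ - v₁) := by
          by_contra h'
          push Not at h'
          have h9 := mul_lt_mul'' h' h' (by linarith only [hδ]) (by linarith only [hδ])
          linarith only [h9, not_le.mp hl, mul_pos hδ hδ]
        have hQ : B₃ - B₁ ≤ 4 * (v₃ - v₁) := by linarith only [hhi', hδ]
        have hPneg : (B₃ - B₁) ^ 2 - 5 * (B₃ - B₁) * (v₃ - v₁) + 2 * (v₃ - v₁) ^ 2 < 0 := by
          by_contra hP'
          push Not at hP'
          exact hs ⟨hP', hQ⟩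
        have hlo' : v₃ - v₁ ≤ 3 * (B₃ - B₁) := by
          by_contra h'
          push Not at h'
          linarith only [mul_lt_mul_of_pos_right h' hδ, sq_nonneg (B₃ - B₁), hPneg, hΔ, hδ, mul_pos hδ hδ]
        have hdd := dd2_of_pure u₁ u₂ u₃ u₄ u₅ v₁ v₂ v₃ hC hP4
        have hkey := key (u₁ - v₁) (u₂ - v₁) (u₃ - v₁) (u₄ - v₁) (u₅ - v₁) (v₃ - v₁) (v₂ - v₁)
          bp₁ bp₂ bp₃ bp₄ bp₅ hc₁ hc₂ hc₃ hc₄ hc₅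
          (sub_nonneg.mpr h12) (by linarith only [h23]) hδ (by linear_combination hdd)
        have kl := psi_low_midTilt (u₁ - v₁) (u₂ - v₁) (u₃ - v₁) (u₄ - v₁) (u₅ - v₁)
          ((A₁ - B₁) - (u₁ - v₁)) ((A₂ - B₁) - (u₂ - v₁)) ((A₃ - B₁) - (u₃ - v₁)) ((A₄ - B₁) - (u₄ - v₁)) ((A₅ - B₁) - (u₅ - v₁)) (v₃ - v₁) (B₃ - B₁)
          bp₁ bp₂ bp₃ bp₄ bp₅ dl₁ dl₂ dl₃ dl₄ dl₅ hq₁ hq₂ hq₃ hq₄ hq₅ hδ.le hlo' hhi' hkey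
        linear_combination kl
  rw [Glam_delta_cubed_13 A₁ A₂ A₃ A₄ A₅ B₁ B₂ B₃ u₁ u₂ u₃ u₄ u₅ v₁ v₂ v₃ hA hC hP1 hP2 hP4 (4 / 3)]
  linarith [hlow, hhigh]

/-- Sorted F-charges, tilt of either sign: the case `B₃ < B₁` is the reflection `u ↦ −u` (which reverses the charge order and
exchanges `F₁ ↔ F₃`) of `allTilts_main`. -/
theorem allTilts_sorted (A₁ A₂ A₃ A₄ A₅ B₁ B₂ B₃ u₁ u₂ u₃ u₄ u₅ v₁ v₂ v₃ : ℝ)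
    (hA : A₁ + A₂ + A₃ + A₄ + A₅ = B₁ + B₂ + B₃) (hC : u₁ + u₂ + u₃ + u₄ + u₅ = v₁ + v₂ + v₃)
    (hP1 : (A₁ ^ 2 * u₁ + A₂ ^ 2 * u₂ + A₃ ^ 2 * u₃ + A₄ ^ 2 * u₄ + A₅ ^ 2 * u₅) - (B₁ ^ 2 * v₁ + B₂ ^ 2 * v₂ + B₃ ^ 2 * v₃) = 0)
    (hP2 : (A₁ * u₁ ^ 2 + A₂ * u₂ ^ 2 + A₃ * u₃ ^ 2 + A₄ * u₄ ^ 2 + A₅ * u₅ ^ 2) - (B₁ * v₁ ^ 2 + B₂ * v₂ ^ 2 + B₃ * v₃ ^ 2) = 0)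
    (hP4 : (u₁ ^ 3 + u₂ ^ 3 + u₃ ^ 3 + u₄ ^ 3 + u₅ ^ 3) - (v₁ ^ 3 + v₂ ^ 3 + v₃ ^ 3) = 0)
    (m₁₁ : |u₁ - v₁| ≤ A₁ - B₁) (m₂₁ : |u₂ - v₁| ≤ A₂ - B₁) (m₃₁ : |u₃ - v₁| ≤ A₃ - B₁) (m₄₁ : |u₄ - v₁| ≤ A₄ - B₁) (m₅₁ : |u₅ - v₁| ≤ A₅ - B₁)
    (m₁₃ : |u₁ - v₃| ≤ A₁ - B₃) (m₂₃ : |u₂ - v₃| ≤ A₂ - B₃) (m₃₃ : |u₃ - v₃| ≤ A₃ - B₃) (m₄₃ : |u₄ - v₃| ≤ A₄ - B₃) (m₅₃ : |u₅ - v₃| ≤ A₅ - B₃)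
    (lo₁ : v₁ ≤ u₁) (lo₂ : v₁ ≤ u₂) (lo₃ : v₁ ≤ u₃) (lo₄ : v₁ ≤ u₄) (lo₅ : v₁ ≤ u₅)
    (hi₁ : u₁ ≤ v₃) (hi₂ : u₂ ≤ v₃) (hi₃ : u₃ ≤ v₃) (hi₄ : u₄ ≤ v₃) (hi₅ : u₅ ≤ v₃)
    (h12 : v₁ ≤ v₂) (h23 : v₂ ≤ v₃) (hlt : v₁ < v₃) :
    0 ≤ (v₃ - v₁) ^ 3 * ((1 / 2) * ((A₁ ^ 2 + A₂ ^ 2 + A₃ ^ 2 + A₄ ^ 2 + A₅ ^ 2) - (B₁ ^ 2 + B₂ ^ 2 + B₃ ^ 2)) * ((u₁ ^ 2 + u₂ ^ 2 + u₃ ^ 2 + u₄ ^ 2 + u₅ ^ 2) - (v₁ ^ 2 + v₂ ^ 2 + v₃ ^ 2))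
        + ((A₁ * u₁ + A₂ * u₂ + A₃ * u₃ + A₄ * u₄ + A₅ * u₅) - (B₁ * v₁ + B₂ * v₂ + B₃ * v₃)) ^ 2
        - 3 * ((A₁ ^ 2 * u₁ ^ 2 + A₂ ^ 2 * u₂ ^ 2 + A₃ ^ 2 * u₃ ^ 2 + A₄ ^ 2 * u₄ ^ 2 + A₅ ^ 2 * u₅ ^ 2) - (B₁ ^ 2 * v₁ ^ 2 + B₂ ^ 2 * v₂ ^ 2 + B₃ ^ 2 * v₃ ^ 2))
      + (4 / 3) * (3 * ((u₁ ^ 4 + u₂ ^ 4 + u₃ ^ 4 + u₄ ^ 4 + u₅ ^ 4) - (v₁ ^ 4 + v₂ ^ 4 + v₃ ^ 4)) - (3 / 2) * ((u₁ ^ 2 + u₂ ^ 2 + u₃ ^ 2 + u₄ ^ 2 + u₅ ^ 2) - (v₁ ^ 2 + v₂ ^ 2 + v₃ ^ 2)) ^ 2)) := by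
  rcases le_total B₁ B₃ with hB | hB
  · exact allTilts_main A₁ A₂ A₃ A₄ A₅ B₁ B₂ B₃ u₁ u₂ u₃ u₄ u₅ v₁ v₂ v₃ hA hC hP1 hP2 hP4 m₁₁ m₂₁ m₃₁ m₄₁ m₅₁ m₁₃ m₂₃ m₃₃ m₄₃ m₅₃
      lo₁ lo₂ lo₃ lo₄ lo₅ hi₁ hi₂ hi₃ hi₄ hi₅ h12 h23 hB hlt
  · have h := allTilts_main A₁ A₂ A₃ A₄ A₅ B₃ B₂ B₁ (-u₁) (-u₂) (-u₃) (-u₄) (-u₅) (-v₃) (-v₂) (-v₁)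
      (by linarith only [hA]) (by linarith only [hC]) (by linear_combination (-1 : ℝ) * hP1) (by linear_combination hP2)
      (by linear_combination (-1 : ℝ) * hP4)
      (by rw [show -u₁ - -v₃ = -(u₁ - v₃) by ring, abs_neg]; exact m₁₃)
      (by rw [show -u₂ - -v₃ = -(u₂ - v₃) by ring, abs_neg]; exact m₂₃)
      (by rw [show -u₃ - -v₃ = -(u₃ - v₃) by ring, abs_neg]; exact m₃₃)
      (by rw [show -u₄ - -v₃ = -(u₄ - v₃) by ring, abs_neg]; exact m₄₃)
      (by rw [show -u₅ - -v₃ = -(u₅ - v₃) by ring, abs_neg]; exact m₅₃)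
      (by rw [show -u₁ - -v₁ = -(u₁ - v₁) by ring, abs_neg]; exact m₁₁)
      (by rw [show -u₂ - -v₁ = -(u₂ - v₁) by ring, abs_neg]; exact m₂₁)
      (by rw [show -u₃ - -v₁ = -(u₃ - v₁) by ring, abs_neg]; exact m₃₁)
      (by rw [show -u₄ - -v₁ = -(u₄ - v₁) by ring, abs_neg]; exact m₄₁)
      (by rw [show -u₅ - -v₁ = -(u₅ - v₁) by ring, abs_neg]; exact m₅₁)
      (by linarith only [hi₁]) (by linarith only [hi₂]) (by linarith only [hi₃]) (by linarith only [hi₄]) (by linarith only [hi₅])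
      (by linarith only [lo₁]) (by linarith only [lo₂]) (by linarith only [lo₃]) (by linarith only [lo₄]) (by linarith only [lo₅])
      (by linarith only [h23]) (by linarith only [h12]) hB (by linarith only [hlt])
    refine h.trans_eq ?_
    ring

/-- **CONJECTURE N, FORMAT (5,3), THE DOUBLY-ONE-SIDED CLASS (all tilts; pv2-g15's LEMMA DOS).** Every centred, pure (P1, P2, P4),
pairwise-ample real (5,3) configuration whose E-charges all lie between the charges of two F-roots (`v₁ ≤ u_e ≤ v₃` for all `e`; the
third F-root and the tilt `(B₃−B₁)/(v₃−v₁)` arbitrary) satisfies `Q₂ + (4/3)·Q₄ ≥ 0`. (The ampleness hypotheses w.r.t. `F₂` enter only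
when `v₂` is itself extreme, through the relabelling.) -/
theorem conjectureN_53_doublyOneSided (A₁ A₂ A₃ A₄ A₅ B₁ B₂ B₃ u₁ u₂ u₃ u₄ u₅ v₁ v₂ v₃ : ℝ)
    (hA : A₁ + A₂ + A₃ + A₄ + A₅ = B₁ + B₂ + B₃) (hC : u₁ + u₂ + u₃ + u₄ + u₅ = v₁ + v₂ + v₃)
    (hP1 : (A₁ ^ 2 * u₁ + A₂ ^ 2 * u₂ + A₃ ^ 2 * u₃ + A₄ ^ 2 * u₄ + A₅ ^ 2 * u₅) - (B₁ ^ 2 * v₁ + B₂ ^ 2 * v₂ + B₃ ^ 2 * v₃) = 0)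
    (hP2 : (A₁ * u₁ ^ 2 + A₂ * u₂ ^ 2 + A₃ * u₃ ^ 2 + A₄ * u₄ ^ 2 + A₅ * u₅ ^ 2) - (B₁ * v₁ ^ 2 + B₂ * v₂ ^ 2 + B₃ * v₃ ^ 2) = 0)
    (hP4 : (u₁ ^ 3 + u₂ ^ 3 + u₃ ^ 3 + u₄ ^ 3 + u₅ ^ 3) - (v₁ ^ 3 + v₂ ^ 3 + v₃ ^ 3) = 0)
    (m₁₁ : |u₁ - v₁| ≤ A₁ - B₁) (m₂₁ : |u₂ - v₁| ≤ A₂ - B₁) (m₃₁ : |u₃ - v₁| ≤ A₃ - B₁) (m₄₁ : |u₄ - v₁| ≤ A₄ - B₁) (m₅₁ : |u₅ - v₁| ≤ A₅ - B₁)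
    (m₁₂ : |u₁ - v₂| ≤ A₁ - B₂) (m₂₂ : |u₂ - v₂| ≤ A₂ - B₂) (m₃₂ : |u₃ - v₂| ≤ A₃ - B₂) (m₄₂ : |u₄ - v₂| ≤ A₄ - B₂) (m₅₂ : |u₅ - v₂| ≤ A₅ - B₂)
    (m₁₃ : |u₁ - v₃| ≤ A₁ - B₃) (m₂₃ : |u₂ - v₃| ≤ A₂ - B₃) (m₃₃ : |u₃ - v₃| ≤ A₃ - B₃) (m₄₃ : |u₄ - v₃| ≤ A₄ - B₃) (m₅₃ : |u₅ - v₃| ≤ A₅ - B₃)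
    (lo₁ : v₁ ≤ u₁) (lo₂ : v₁ ≤ u₂) (lo₃ : v₁ ≤ u₃) (lo₄ : v₁ ≤ u₄) (lo₅ : v₁ ≤ u₅)
    (hi₁ : u₁ ≤ v₃) (hi₂ : u₂ ≤ v₃) (hi₃ : u₃ ≤ v₃) (hi₄ : u₄ ≤ v₃) (hi₅ : u₅ ≤ v₃) :
    0 ≤ (1 / 2) * ((A₁ ^ 2 + A₂ ^ 2 + A₃ ^ 2 + A₄ ^ 2 + A₅ ^ 2) - (B₁ ^ 2 + B₂ ^ 2 + B₃ ^ 2)) * ((u₁ ^ 2 + u₂ ^ 2 + u₃ ^ 2 + u₄ ^ 2 + u₅ ^ 2) - (v₁ ^ 2 + v₂ ^ 2 + v₃ ^ 2))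
        + ((A₁ * u₁ + A₂ * u₂ + A₃ * u₃ + A₄ * u₄ + A₅ * u₅) - (B₁ * v₁ + B₂ * v₂ + B₃ * v₃)) ^ 2
        - 3 * ((A₁ ^ 2 * u₁ ^ 2 + A₂ ^ 2 * u₂ ^ 2 + A₃ ^ 2 * u₃ ^ 2 + A₄ ^ 2 * u₄ ^ 2 + A₅ ^ 2 * u₅ ^ 2) - (B₁ ^ 2 * v₁ ^ 2 + B₂ ^ 2 * v₂ ^ 2 + B₃ ^ 2 * v₃ ^ 2))
      + (4 / 3) * (3 * ((u₁ ^ 4 + u₂ ^ 4 + u₃ ^ 4 + u₄ ^ 4 + u₅ ^ 4) - (v₁ ^ 4 + v₂ ^ 4 + v₃ ^ 4)) - (3 / 2) * ((u₁ ^ 2 + u₂ ^ 2 + u₃ ^ 2 + u₄ ^ 2 + u₅ ^ 2) - (v₁ ^ 2 + v₂ ^ 2 + v₃ ^ 2)) ^ 2) := by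
  have hδ0 : v₁ ≤ v₃ := le_trans lo₁ hi₁
  rcases eq_or_lt_of_le hδ0 with heq | hlt
  · -- degenerate: all charges coincide, then P4 + centring force them to vanish
    clear m₁₁ m₂₁ m₃₁ m₄₁ m₅₁ m₁₂ m₂₂ m₃₂ m₄₂ m₅₂ m₁₃ m₂₃ m₃₃ m₄₃ m₅₃ hP1 hP2 hA
    have e₁ : u₁ = v₁ := le_antisymm (heq ▸ hi₁) lo₁
    have e₂ : u₂ = v₁ := le_antisymm (heq ▸ hi₂) lo₂
    have e₃ : u₃ = v₁ := le_antisymm (heq ▸ hi₃) lo₃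
    have e₄ : u₄ = v₁ := le_antisymm (heq ▸ hi₄) lo₄
    have e₅ : u₅ = v₁ := le_antisymm (heq ▸ hi₅) lo₅
    have ev₂ : v₂ = 3 * v₁ := by rw [e₁, e₂, e₃, e₄, e₅, ← heq] at hC; linarith
    have ev₁ : v₁ = 0 := by
      rw [e₁, e₂, e₃, e₄, e₅, ← heq, ev₂] at hP4
      have : v₁ ^ 3 = 0 := by ring_nf at hP4; linarith
      exact pow_eq_zero_iff (n := 3) (by norm_num) |>.mp this
    subst e₁ e₂ e₃ e₄ e₅
    rw [← heq, ev₂, ev₁]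
    ring_nf
    positivity
  · rcases le_or_gt v₁ v₂ with h12 | h21
    · rcases le_or_gt v₂ v₃ with h23 | h32
      · have hprod := allTilts_sorted A₁ A₂ A₃ A₄ A₅ B₁ B₂ B₃ u₁ u₂ u₃ u₄ u₅ v₁ v₂ v₃ hA hC hP1 hP2 hP4 m₁₁ m₂₁ m₃₁ m₄₁ m₅₁ m₁₃ m₂₃ m₃₃ m₄₃ m₅₃
          lo₁ lo₂ lo₃ lo₄ lo₅ hi₁ hi₂ hi₃ hi₄ hi₅ h12 h23 hlt
        exact (mul_nonneg_iff_of_pos_left (pow_pos (sub_pos.mpr hlt) 3)).mp hprod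
      · -- v₁ ≤ v₃ < v₂ : the extreme pair is (F₁, F₂)
        have hprod := allTilts_sorted A₁ A₂ A₃ A₄ A₅ B₁ B₃ B₂ u₁ u₂ u₃ u₄ u₅ v₁ v₃ v₂
          (by linarith only [hA]) (by linarith only [hC]) (by linear_combination hP1) (by linear_combination hP2)
          (by linear_combination hP4)
          m₁₁ m₂₁ m₃₁ m₄₁ m₅₁ m₁₂ m₂₂ m₃₂ m₄₂ m₅₂
          lo₁ lo₂ lo₃ lo₄ lo₅ (by linarith only [hi₁, h32]) (by linarith only [hi₂, h32]) (by linarith only [hi₃, h32])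
          (by linarith only [hi₄, h32]) (by linarith only [hi₅, h32]) hδ0 h32.le (by linarith only [hlt, h32])
        have := (mul_nonneg_iff_of_pos_left (pow_pos (by linarith only [hlt, h32] : (0:ℝ) < v₂ - v₁) 3)).mp hprod
        refine this.trans_eq ?_
        ring
    · -- v₂ < v₁ ≤ v₃ : the extreme pair is (F₂, F₃)
      have hprod := allTilts_sorted A₁ A₂ A₃ A₄ A₅ B₂ B₁ B₃ u₁ u₂ u₃ u₄ u₅ v₂ v₁ v₃
        (by linarith only [hA]) (by linarith only [hC]) (by linear_combination hP1) (by linear_combination hP2)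
        (by linear_combination hP4)
        m₁₂ m₂₂ m₃₂ m₄₂ m₅₂ m₁₃ m₂₃ m₃₃ m₄₃ m₅₃
        (by linarith only [lo₁, h21]) (by linarith only [lo₂, h21]) (by linarith only [lo₃, h21]) (by linarith only [lo₄, h21])
        (by linarith only [lo₅, h21]) hi₁ hi₂ hi₃ hi₄ hi₅ h21.le hδ0 (by linarith only [hlt, h21])
      have := (mul_nonneg_iff_of_pos_left (pow_pos (by linarith only [hlt, h21] : (0:ℝ) < v₃ - v₂) 3)).mp hprod
      refine this.trans_eq ?_
      ring

end Summit.HodgeConjecture.HodgeConjecture.WeilClassTestFormatFiveThreeDoublyOneSidedAllTilts
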